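import Summits.CriticalPhenomena.PercolationContinuityZ3.Theorems.PercNearOneGluingNoHeavyQuantIndepBlobTwoLevelRow
import HarnessLib

/-!
# QUANT lane R8, FAR for independent blobs (VI): the ODD-SIZE two-level row and the COMPANION row —
# `Σ a ≥ 2j+1`, all gates `≥ 1/2` ⟹ `P(W ≥ j+1) + P(W ≥ j) ≥ 2·g`, and one sub-floor companion blob completes the size row

builds on p205010 (kernel theorem, internal audit signed; external expert review pending)

Support file (`--supports stmt-CriticalPhenomena-4575`), QUANT lane lead (gen 15); memo
`run/shared/lean/prim/quant/prim-quant-lead-g15/LEAD-NOTES-G15.md` N26–N27.  Theorems only (vocabulary of `…QuantIndepBlobTwoLevelRow` /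
`…QuantIndepBlobGapRow`), no definitions, no sorries, standard axioms.

**Why.**  The R8 architecture of record for FAR on general trees (census-2 gen 49, ARCH-TREES-G49; quant README V185) reduces `Quant.FarTreeRow`
to one inequality for INDEPENDENT blobs in which some blobs are LIGHT (gate below the floor `g` of the heavy ones) and are credited at a discount
(Conjecture DIB*).  In the Hall–Harris regime (least heavy gate `g ≥ 1/2`) the size row `Σ a ≥ 2(j+1) ⟹ P(W ≥ j+1) ≥ g`
(`IndepBlob.tail_ge_gate_of_two_mul_le_size`) settles DIB* whenever the heavy sizes total `≥ 2j+2`, light blobs or not.  This file does the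
next case, heavy total `2j+1`: the missing unit may be supplied by ANY independent companion blob of gate `≥ 1/2`, even one below the floor `g`,
and no mean / credit hypothesis is needed.

* `Quant.IndepBlob.twoLevelSizeRow_of_half_le_gate` — gates `p y₀ ≤ p k ≤ 1` with `1/2 ≤ p y₀`, integer sizes `a k ≥ 1`, a level `j` with
  `2j + 1 ≤ Σ_k a k`: `2 · p y₀ ≤ P(j+1 ≤ W) + P(j ≤ W)` — the ADJACENT two-level row under a SIZE hypothesis (the size row gives each term `≥ p y₀`
  only from `Σ a ≥ 2j+2` resp. `≥ 2j`; at odd total size the two levels average to the floor).  Proof: condition on `y₀` (`tail_split`) and apply p1's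
  two-threshold transport `gapRow_of_half_le_gate` to the other blobs twice, with thresholds `(j − a y₀, j+1)` and `(j+1 − a y₀, j)` (both sum to
  `2j + 1 − a y₀ ≤ Σ_{k ≠ y₀} a k`).  Sharp: one blob of size `2j+1` (both terms `= p y₀`).
* `Quant.IndepBlob.convexLevelRow_of_half_le_gate` — hence `p y₀ ≤ θ·P(j ≤ W) + (1 − θ)·P(j+1 ≤ W)` for every `θ ∈ [1/2, 1]`.
* `Quant.IndepBlob.companion_sizeRow_of_half_le_gate` — **COMPANION ROW**: blobs on `κ` with a distinguished companion `x₀` (`1/2 ≤ p x₀ ≤ 1`,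
  `a x₀ ≥ 1`, NO relation to the floor) and heavy floor `y₀ ≠ x₀` (`1/2 ≤ p y₀ ≤ p k` for `k ≠ x₀`), sizes `a k ≥ 1` with `2j + 1 + a x₀ ≤ Σ_k a k`:
  `p y₀ ≤ P(j+1 ≤ W)`.  (Condition on `x₀`: `P(j+1 ≤ W) ≥ p x₀·P'(j ≤ W') + (1 − p x₀)·P'(j+1 ≤ W')`, and the previous row for the other blobs with
  `θ = p x₀`.)  For DIB* this is the sub-case 'least heavy gate `≥ 1/2`, heavy total `≥ 2j+1`, light blob of gate `≥ 1/2`' with the light credit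
  not even used; the same averaging gives the row for any independent companion count `L` with `P(L = 0) ≤ 1/2` (law level; not typed here).
Exact second check (lead g15, `prim-quant-lead-g15/explore/oddsize.py`, `r1test.py`): 9 611 + 8 000 rational instances, 0 failures, equality at
one heavy blob of size `2j+1`.  Nearest prior art: as recorded in `…QuantIndepBlobFar.lean` / `…HalfRow.lean` (small-ball and median bounds for
Bernoulli sums give neither the gate-wise constant nor the companion freedom).  [this work]
-/

namespace Summit.CriticalPhenomena.PercolationContinuityZ3.Theorems

namespace Quant

namespace IndepBlob

open Finset

variable {κ : Type*} [Fintype κ] [DecidableEq κ]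

/-- **Odd-size two-level row, all gates `≥ 1/2`.**  For gates `0 ≤ p k ≤ 1` with a least reliable blob `y₀` (`p y₀ ≤ p k`, `1/2 ≤ p y₀`),
integer sizes `a k ≥ 1` and a level `j` with `2j + 1 ≤ Σ_k a k`:
`2 · p y₀ ≤ Σ_{s : j+1 ≤ a(s)} w(s) + Σ_{s : j ≤ a(s)} w(s)` (`= P(W ≥ j+1) + P(W ≥ j)`).  Equality for a single blob of size `2j+1`. [this work] -/
theorem twoLevelSizeRow_of_half_le_gate (p : κ → ℝ) (a : κ → ℕ) (hp0 : ∀ k, 0 ≤ p k) (hp1 : ∀ k, p k ≤ 1)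
    (ha : ∀ k, 1 ≤ a k) (y₀ : κ) (hy₀ : ∀ k, p y₀ ≤ p k) (hhalf : 1 / 2 ≤ p y₀) (j : ℕ)
    (hsize : 2 * j + 1 ≤ ∑ k, a k) :
    2 * p y₀ ≤
      ∑ s ∈ (Finset.univ : Finset (Finset κ)).filter (fun s => j + 1 ≤ ∑ k ∈ s, a k), (∏ k, if k ∈ s then p k else 1 - p k) +
        ∑ s ∈ (Finset.univ : Finset (Finset κ)).filter (fun s => j ≤ ∑ k ∈ s, a k), (∏ k, if k ∈ s then p k else 1 - p k) := by
  set ι := {k : κ // k ≠ y₀} with hι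
  set g : ℝ := p y₀ with hg
  have hg1 : g ≤ 1 := hp1 y₀
  have hw0' : ∀ W : Finset ι, 0 ≤ (∏ i : ι, if i ∈ W then p i else 1 - p i) :=
    bernoulliWeight_nonneg (fun i => hp0 i) (fun i => hp1 i)
  -- the four conditional probabilities
  set A1 : ℝ := ∑ W ∈ (Finset.univ : Finset (Finset ι)).filter (fun W : Finset ι => j + 1 ≤ a y₀ + ∑ i ∈ W, a (i : κ)),
      (∏ i : ι, if i ∈ W then p i else 1 - p i) with hA1
  set A2 : ℝ := ∑ W ∈ (Finset.univ : Finset (Finset ι)).filter (fun W : Finset ι => j ≤ a y₀ + ∑ i ∈ W, a (i : κ)),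
      (∏ i : ι, if i ∈ W then p i else 1 - p i) with hA2
  set B1 : ℝ := ∑ W ∈ (Finset.univ : Finset (Finset ι)).filter (fun W : Finset ι => j + 1 ≤ ∑ i ∈ W, a (i : κ)),
      (∏ i : ι, if i ∈ W then p i else 1 - p i) with hB1
  set B2 : ℝ := ∑ W ∈ (Finset.univ : Finset (Finset ι)).filter (fun W : Finset ι => j ≤ ∑ i ∈ W, a (i : κ)),
      (∏ i : ι, if i ∈ W then p i else 1 - p i) with hB2
  rw [tail_split p a y₀ (j + 1), tail_split p a y₀ j]
  show 2 * g ≤ g * A1 + (1 - g) * B1 + (g * A2 + (1 - g) * B2)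
  have htot := sum_bernoulliWeight (fun i : ι => p i)
  -- complements of `A1`, `A2` as strict lower tails of `W'` with real thresholds
  have hcA1 : 1 - A1 = ∑ W ∈ (Finset.univ : Finset (Finset ι)).filter
      (fun W : Finset ι => ∑ i ∈ W, ((a (i : κ) : ℕ) : ℝ) < (j : ℝ) + 1 - a y₀), (∏ i : ι, if i ∈ W then p i else 1 - p i) := by
    have hc := Finset.sum_filter_add_sum_filter_not (Finset.univ : Finset (Finset ι))
      (fun W : Finset ι => j + 1 ≤ a y₀ + ∑ i ∈ W, a (i : κ)) (fun W : Finset ι => (∏ i : ι, if i ∈ W then p i else 1 - p i))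
    rw [htot] at hc
    have he : (Finset.univ : Finset (Finset ι)).filter (fun W : Finset ι => ¬ (j + 1 ≤ a y₀ + ∑ i ∈ W, a (i : κ))) =
        (Finset.univ : Finset (Finset ι)).filter (fun W : Finset ι => ∑ i ∈ W, ((a (i : κ) : ℕ) : ℝ) < (j : ℝ) + 1 - a y₀) := by
      refine Finset.filter_congr fun W _ => ?_
      rw [not_le]
      constructor
      · intro hlt
        have : ((a y₀ + ∑ i ∈ W, a (i : κ) : ℕ) : ℝ) < ((j + 1 : ℕ) : ℝ) := by exact_mod_cast hlt
        push_cast at this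
        linarith
      · intro hlt
        have : ((a y₀ : ℝ) + ∑ i ∈ W, ((a (i : κ) : ℕ) : ℝ)) < (j : ℝ) + 1 := by linarith
        exact_mod_cast this
    rw [← he]
    linarith
  have hcA2 : 1 - A2 = ∑ W ∈ (Finset.univ : Finset (Finset ι)).filter
      (fun W : Finset ι => ∑ i ∈ W, ((a (i : κ) : ℕ) : ℝ) < (j : ℝ) - a y₀), (∏ i : ι, if i ∈ W then p i else 1 - p i) := by
    have hc := Finset.sum_filter_add_sum_filter_not (Finset.univ : Finset (Finset ι))
      (fun W : Finset ι => j ≤ a y₀ + ∑ i ∈ W, a (i : κ)) (fun W : Finset ι => (∏ i : ι, if i ∈ W then p i else 1 - p i))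
    rw [htot] at hc
    have he : (Finset.univ : Finset (Finset ι)).filter (fun W : Finset ι => ¬ (j ≤ a y₀ + ∑ i ∈ W, a (i : κ))) =
        (Finset.univ : Finset (Finset ι)).filter (fun W : Finset ι => ∑ i ∈ W, ((a (i : κ) : ℕ) : ℝ) < (j : ℝ) - a y₀) := by
      refine Finset.filter_congr fun W _ => ?_
      rw [not_le]
      constructor
      · intro hlt
        have : ((a y₀ + ∑ i ∈ W, a (i : κ) : ℕ) : ℝ) < ((j : ℕ) : ℝ) := by exact_mod_cast hlt
        push_cast at this
        linarith
      · intro hlt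
        have : ((a y₀ : ℝ) + ∑ i ∈ W, ((a (i : κ) : ℕ) : ℝ)) < (j : ℝ) := by linarith
        exact_mod_cast this
    rw [← he]
    linarith
  -- `B1`, `B2` with real thresholds
  have hrB1 : B1 = ∑ W ∈ (Finset.univ : Finset (Finset ι)).filter
      (fun W : Finset ι => (j : ℝ) + 1 ≤ ∑ i ∈ W, ((a (i : κ) : ℕ) : ℝ)), (∏ i : ι, if i ∈ W then p i else 1 - p i) := by
    rw [hB1]
    refine Finset.sum_congr (Finset.filter_congr fun W _ => ?_) fun _ _ => rfl
    constructor
    · intro hle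
      have : ((j + 1 : ℕ) : ℝ) ≤ ((∑ i ∈ W, a (i : κ) : ℕ) : ℝ) := by exact_mod_cast hle
      push_cast at this
      linarith
    · intro hle
      have : (j : ℝ) + 1 ≤ ∑ i ∈ W, ((a (i : κ) : ℕ) : ℝ) := hle
      exact_mod_cast this
  have hrB2 : B2 = ∑ W ∈ (Finset.univ : Finset (Finset ι)).filter
      (fun W : Finset ι => (j : ℝ) ≤ ∑ i ∈ W, ((a (i : κ) : ℕ) : ℝ)), (∏ i : ι, if i ∈ W then p i else 1 - p i) := by
    rw [hB2]
    refine Finset.sum_congr (Finset.filter_congr fun W _ => ?_) fun _ _ => rfl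
    constructor
    · intro hle
      have : ((j : ℕ) : ℝ) ≤ ((∑ i ∈ W, a (i : κ) : ℕ) : ℝ) := by exact_mod_cast hle
      push_cast at this
      linarith
    · intro hle
      have : (j : ℝ) ≤ ∑ i ∈ W, ((a (i : κ) : ℕ) : ℝ) := hle
      exact_mod_cast this
  -- total size of the other blobs: `2j + 1 − a y₀ ≤ Σ' a`
  have hsize' : 2 * (j : ℝ) + 1 - a y₀ ≤ ∑ i : ι, ((a (i : κ) : ℕ) : ℝ) := by
    have hsplit : ∑ k, a k = a y₀ + ∑ i : ι, a (i : κ) := by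
      rw [← Finset.add_sum_erase Finset.univ _ (Finset.mem_univ y₀),
        Finset.sum_subtype (Finset.univ.erase y₀) (p := fun k => k ≠ y₀) (fun k => by simp)]
    rw [hsplit] at hsize
    have : ((2 * j + 1 : ℕ) : ℝ) ≤ ((a y₀ + ∑ i : ι, a (i : κ) : ℕ) : ℝ) := by exact_mod_cast hsize
    push_cast at this
    linarith
  have ha1 : (1 : ℝ) ≤ a y₀ := by exact_mod_cast ha y₀
  -- Row 1: thresholds `(j − a y₀, j + 1)`:  `g · (1 − A2) ≤ (1 − g) · B1`
  have hrow1 : g * (1 - A2) ≤ (1 - g) * B1 := by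
    have := gapRow_of_half_le_gate (fun i : ι => p i) (fun i : ι => ((a (i : κ) : ℕ) : ℝ)) g hhalf hg1
      (fun i => hy₀ i) (fun i => hp1 i) (fun i => by positivity) ((j : ℝ) - a y₀) ((j : ℝ) + 1)
      (by linarith) (by linarith)
    rw [hcA2, hrB1]
    exact this
  -- Row 2: thresholds `(j + 1 − a y₀, j)`:  `g · (1 − A1) ≤ (1 − g) · B2`
  have hrow2 : g * (1 - A1) ≤ (1 - g) * B2 := by
    have := gapRow_of_half_le_gate (fun i : ι => p i) (fun i : ι => ((a (i : κ) : ℕ) : ℝ)) g hhalf hg1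
      (fun i => hy₀ i) (fun i => hp1 i) (fun i => by positivity) ((j : ℝ) + 1 - a y₀) (j : ℝ)
      (by linarith) (by linarith)
    rw [hcA1, hrB2]
    exact this
  nlinarith

/-- **Convex two-level row.**  In the setting of `twoLevelSizeRow_of_half_le_gate`, for every `θ` with `1/2 ≤ θ ≤ 1`:
`p y₀ ≤ θ · P(W ≥ j) + (1 − θ) · P(W ≥ j+1)` (the larger tail may carry any weight `θ ≥ 1/2`; for `θ ≤ 1` this is a convex combination). [this work] -/
theorem convexLevelRow_of_half_le_gate (p : κ → ℝ) (a : κ → ℕ) (hp0 : ∀ k, 0 ≤ p k) (hp1 : ∀ k, p k ≤ 1)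
    (ha : ∀ k, 1 ≤ a k) (y₀ : κ) (hy₀ : ∀ k, p y₀ ≤ p k) (hhalf : 1 / 2 ≤ p y₀) (j : ℕ)
    (hsize : 2 * j + 1 ≤ ∑ k, a k) (θ : ℝ) (hθ : 1 / 2 ≤ θ) :
    p y₀ ≤
      θ * ∑ s ∈ (Finset.univ : Finset (Finset κ)).filter (fun s => j ≤ ∑ k ∈ s, a k), (∏ k, if k ∈ s then p k else 1 - p k) +
        (1 - θ) * ∑ s ∈ (Finset.univ : Finset (Finset κ)).filter (fun s => j + 1 ≤ ∑ k ∈ s, a k),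
          (∏ k, if k ∈ s then p k else 1 - p k) := by
  have htwo := twoLevelSizeRow_of_half_le_gate p a hp0 hp1 ha y₀ hy₀ hhalf j hsize
  have hw0 : ∀ s : Finset κ, 0 ≤ (∏ k, if k ∈ s then p k else 1 - p k) := bernoulliWeight_nonneg hp0 hp1
  -- the upper level is the smaller event
  have hUV : ∑ s ∈ (Finset.univ : Finset (Finset κ)).filter (fun s => j + 1 ≤ ∑ k ∈ s, a k), (∏ k, if k ∈ s then p k else 1 - p k) ≤
      ∑ s ∈ (Finset.univ : Finset (Finset κ)).filter (fun s => j ≤ ∑ k ∈ s, a k), (∏ k, if k ∈ s then p k else 1 - p k) := by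
    refine Finset.sum_le_sum_of_subset_of_nonneg (fun s hs => ?_) fun s _ _ => hw0 s
    rw [Finset.mem_filter] at hs ⊢
    exact ⟨hs.1, by omega⟩
  nlinarith

/-- **COMPANION ROW.**  Blobs on `κ` with gates `0 ≤ p k ≤ 1` and integer sizes `a k ≥ 1`; a companion blob `x₀` with `1/2 ≤ p x₀` (it may lie
BELOW the floor); a heavy floor `y₀ ≠ x₀` with `1/2 ≤ p y₀ ≤ p k` for every `k ≠ x₀`; and a level `j` with `2j + 1 + a x₀ ≤ Σ_k a k` (the blobs
other than the companion total at least `2j + 1`).  Then `p y₀ ≤ P(W ≥ j+1) = Σ_{s : j+1 ≤ a(s)} w(s)`.  The size row needs total `2j+2` of blobs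
ALL above the floor; here one of them is excused to any gate `≥ 1/2`.  Equality for `a = (2j+1, 1)` with the companion the unit. [this work] -/
theorem companion_sizeRow_of_half_le_gate (p : κ → ℝ) (a : κ → ℕ) (hp0 : ∀ k, 0 ≤ p k) (hp1 : ∀ k, p k ≤ 1)
    (ha : ∀ k, 1 ≤ a k) (x₀ y₀ : κ) (hne : y₀ ≠ x₀) (hx₀ : 1 / 2 ≤ p x₀)
    (hy₀ : ∀ k, k ≠ x₀ → p y₀ ≤ p k) (hhalf : 1 / 2 ≤ p y₀) (j : ℕ)
    (hsize : 2 * j + 1 + a x₀ ≤ ∑ k, a k) :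
    p y₀ ≤ ∑ s ∈ (Finset.univ : Finset (Finset κ)).filter (fun s => j + 1 ≤ ∑ k ∈ s, a k), (∏ k, if k ∈ s then p k else 1 - p k) := by
  set ι := {k : κ // k ≠ x₀} with hι
  have hw0' : ∀ W : Finset ι, 0 ≤ (∏ i : ι, if i ∈ W then p i else 1 - p i) :=
    bernoulliWeight_nonneg (fun i => hp0 i) (fun i => hp1 i)
  set A : ℝ := ∑ W ∈ (Finset.univ : Finset (Finset ι)).filter (fun W : Finset ι => j + 1 ≤ a x₀ + ∑ i ∈ W, a (i : κ)),
      (∏ i : ι, if i ∈ W then p i else 1 - p i) with hA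
  set U : ℝ := ∑ W ∈ (Finset.univ : Finset (Finset ι)).filter (fun W : Finset ι => j + 1 ≤ ∑ i ∈ W, a (i : κ)),
      (∏ i : ι, if i ∈ W then p i else 1 - p i) with hU
  set V : ℝ := ∑ W ∈ (Finset.univ : Finset (Finset ι)).filter (fun W : Finset ι => j ≤ ∑ i ∈ W, a (i : κ)),
      (∏ i : ι, if i ∈ W then p i else 1 - p i) with hV
  rw [tail_split p a x₀ (j + 1)]
  show p y₀ ≤ p x₀ * A + (1 - p x₀) * U
  -- `A ≥ V`: with the companion open, level `j` of the others suffices (`a x₀ ≥ 1`)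
  have hAV : V ≤ A := by
    refine Finset.sum_le_sum_of_subset_of_nonneg (fun W hW => ?_) fun W _ _ => hw0' W
    rw [Finset.mem_filter] at hW ⊢
    have := ha x₀
    exact ⟨hW.1, by omega⟩
  -- the other blobs: sizes total `≥ 2j + 1`, floor `⟨y₀, hne⟩`, all gates `≥ p y₀ ≥ 1/2`
  have hsize' : 2 * j + 1 ≤ ∑ i : ι, a (i : κ) := by
    have hsplit : ∑ k, a k = a x₀ + ∑ i : ι, a (i : κ) := by
      rw [← Finset.add_sum_erase Finset.univ _ (Finset.mem_univ x₀),
        Finset.sum_subtype (Finset.univ.erase x₀) (p := fun k => k ≠ x₀) (fun k => by simp)]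
    rw [hsplit] at hsize
    omega
  have hconv := convexLevelRow_of_half_le_gate (fun i : ι => p i) (fun i : ι => a (i : κ)) (fun i => hp0 i) (fun i => hp1 i)
    (fun i => ha i) ⟨y₀, hne⟩ (fun i => hy₀ i i.2) hhalf j hsize' (p x₀) hx₀
  -- `hconv : p y₀ ≤ p x₀ * V + (1 - p x₀) * U`
  have hpx : 0 ≤ p x₀ := hp0 x₀
  calc p y₀ ≤ p x₀ * V + (1 - p x₀) * U := hconv
    _ ≤ p x₀ * A + (1 - p x₀) * U := by nlinarith

end IndepBlob

end Quant

end Summit.CriticalPhenomena.PercolationContinuityZ3.Theorems
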